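import Literature.Topology.FourManifolds.LatticeFormsStableOrthogonalGroupStabiliser
import HarnessLib

/-!
# `Õ(L) = O(L)` when `|D(L)| ≤ 2`, and `Õ(L_{2,2d}) = Õ(L_2, h_d) = O(L_2, h_d)` for the Beauville lattice
# `L_2 = 3U ⊕ 2E₈(−1) ⊕ ⟨−2⟩` of `K3^{[2]}` (Gritsenko–Hulek–Sankaran, *Compositio Math.* 146 (2010) §5, from
# Prop. 4.12 (i) and Cor. 4.13)

Trunk T-4MAN vocabulary; sequel of `LatticeFormsStableOrthogonalGroupStabiliser.lean` (row g42-#2: Prop. 4.12 (i)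
`Õ(h^⊥) = {G|_{h^⊥} | G ∈ Õ(L), G h = h}` for every nondegenerate `L`) and `LatticeFormsStableOrthogonalGroupSublattice.lean`
(row g42-#1). Models as in `LatticeFormsNegTwoVectorOrbits.lean` (`B₀ ⊕ ⟨−2t⟩ = B₀.prod ((−2t) • mul)`,
`(E₈(−1)^{⊕m} ⊕ U^{⊕k}) ⊕ ℤ(−2t)`). Written for lane `lit-hodgefound` (Track 2 foundations; prover seat
`lit-hodgefound-p18`, gen 42, row g42-#4). THEOREMS ONLY — no definition, no named fact, no instance, no notation.

## Source, verbatim (V. Gritsenko, K. Hulek, G. K. Sankaran, Compositio Math. 146 (2010) 404–434, arXiv numbering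
§4–§5, held text `paper:arxiv-0802.2078` pp. 12–14)

"**Corollary 4.13.** We have that `O(L_{2t}, h_d) ≅ Õ(L_{2t}, h_d)` in the following three cases: `f` is odd and
`f = t`; or `f = 2t`; or `f = t` and `2d/f` is odd. […] **5 Modular forms and root systems.** For the rest of the paper
we restrict to a special class of symplectic 4-folds. We consider the case of deformation `K3^{[2]}` manifolds with
polarisation of degree `2d` of split type […] In this case, where `t = 1`, we have
`Õ(L_{2,2d}) = Õ(L_2, h_d) = O(L_2, h_d)` by Proposition 4.12 (i) and Corollary 4.13, where `L_{2,2d}` is as defined in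
Equation (15) [`(h_d)^⊥_{L_{2t}} ≅ L_{2t,2d} = 2U ⊕ 2E₈(−1) ⊕ ⟨−2t⟩ ⊕ ⟨−2d⟩`]. In particular the vertical map in
Theorem 3.? is of degree `1`."

## Contents (all proved) and reading notes

* §1 **`|D(L)| ≤ 2 ⟹ Õ(L) = O(L)`** for any nondegenerate lattice: a group of order `≤ 2` has no non-trivial
  automorphism (`discriminantGroupCongr_eq_self_of_natCard_le_two`). This is the mechanism behind the case `t = 1` of
  Cor. 4.13 (`D(L_2) ≅ ℤ/2`), and it contains the unimodular case `|D(L)| = 1` of Huybrechts' Cor. 14.2.7.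
* §2 Consequently, for such `L` and every `h` with `(h, h) ≠ 0` (resp. every `S` with `B|_{S^⊥}` nondegenerate),
  **`Õ(h^⊥) = {G|_{h^⊥} | G ∈ O(L), G h = h} = O(L, h)|_{h^⊥}`** — Prop. 4.12 (i) with `Õ(L, h) = O(L, h)`
  (`setOf_discriminantGroupCongr_eq_id_eq_setOf_exists_apply_eq_of_natCard_le_two`, `…_forall_apply_eq_…` for `S`),
  and every isometry fixing `h` restricts into `Õ(h^⊥)` (`exists_restrict_discriminantGroupCongr_eq_id_of_apply_eq_of_natCard_le_two`).
* §3 `|D(B₀ ⊕ ⟨−2t⟩)| = 2t` for `B₀` symmetric unimodular (`natCard_discriminantGroup_prod_neg_twoMul_smul_mul`); for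
  `t = 1` every isometry of `L_2`-type lattices `B₀ ⊕ ⟨−2⟩` is stable (`discriminantGroupCongr_eq_self_of_prod_neg_two`)
  and **`Õ(L_{2,2d}) = Õ(L_2, h_d) = O(L_2, h_d)`**: `{g ∈ O(h^⊥) | ḡ = id} = {G|_{h^⊥} | G ∈ O(L_2), G h = h}` for
  every `h ∈ B₀ ⊕ ⟨−2⟩` with `h² = 2d ≠ 0` (`setOf_discriminantGroupCongr_eq_id_eq_of_prod_neg_two`) and for the model
  `(E₈(−1)^{⊕m} ⊕ U^{⊕k}) ⊕ ℤ(−2)` (`…_of_model_one`; `L_2`: `m = 2`, `k = 3`). The printed route is Prop. 4.12 (ii)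
  (order `2^{ρ(t/f)} = 2^{ρ(1)} = 1`); the route here is `|D(L_2)| = 2` directly — the other two cases of Cor. 4.13 and
  Prop. 4.12 (ii) are not in this file. GROUPS: no `Õ⁺`; `Õ = {g | ḡ = id}`, `O(L, h) = {g | g h = h}` as in the sibling
  files; the identification `(h_d)^⊥ ≅ L_{2,2d}` for split `h_d` is `LatticeFormsPolarisationTypesSplitNonsplit.lean`.

## References

* [GritsenkoHulekSankaran2010Symplectic] V. Gritsenko, K. Hulek, G. K. Sankaran, Moduli spaces of irreducible symplectic
  manifolds, Compositio Math. 146 (2010) 404–434 (arXiv:0802.2078): §4 Prop. 4.12, Cor. 4.13; §5 (the display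
  `Õ(L_{2,2d}) = Õ(L_2, h_d) = O(L_2, h_d)`).
* [Huybrechts2016K3] D. Huybrechts, Lectures on K3 Surfaces, CUP 2016, Ch. 14 Cor. 2.7 (the case `|D(L)| = 1`).
-/

noncomputable section

open Module Function
open LinearMap (BilinForm)
open Literature.Topology.FourManifolds

namespace LinearMap.BilinForm

/-! ### §1 `|D(L)| ≤ 2 ⟹` every isometry acts trivially on `D(L)` -/

section Small

variable {M : Type*} [AddCommGroup M] (B : BilinForm ℤ M) [Module.Finite ℤ M] [Module.Free ℤ M]

/-- In a group of order `≤ 2` any two non-zero elements coincide. [folklore] -/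
private theorem eq_of_ne_zero_of_natCard_le_two {A : Type*} [AddCommGroup A] [Finite A] (h2 : Nat.card A ≤ 2)
    {x y : A} (hx : x ≠ 0) (hy : y ≠ 0) : x = y := by
  by_contra hxy
  haveI := Fintype.ofFinite A
  have h3 := Fintype.two_lt_card_iff.2 ⟨0, x, y, hx.symm, hy.symm, hxy⟩
  rw [← Nat.card_eq_fintype_card] at h3
  omega

/-- **`|D(L)| ≤ 2 ⟹ Õ(L) = O(L)`**: if the discriminant group of a nondegenerate lattice has order at most `2`, every
isometry `g` acts trivially on it (`ḡ a` and `a` are both the non-zero element when `a ≠ 0`). For `L_2 = 3U ⊕ 2E₈(−1) ⊕ ⟨−2⟩`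
(`D(L_2) ≅ ℤ/2`) this is "`Õ(L_2, h_d) = O(L_2, h_d)`". [cite: GritsenkoHulekSankaran2010Symplectic, §5 ("In this case, where `t = 1`, we have `Õ(L_{2,2d}) = Õ(L_2,h_d) = O(L_2,h_d)`") and §4 Cor. 4.13] -/
theorem discriminantGroupCongr_eq_self_of_natCard_le_two (hB : B.Nondegenerate) (h2 : Nat.card B.discriminantGroup ≤ 2)
    (g : B.IsometryEquiv B) (a : B.discriminantGroup) : g.discriminantGroupCongr a = a := by
  haveI : Finite B.discriminantGroup := finite_discriminantGroup B hB
  by_cases ha : a = 0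
  · rw [ha, map_zero]
  · exact eq_of_ne_zero_of_natCard_le_two h2 ((LinearEquiv.map_ne_zero_iff _).2 ha) ha

/-! ### §2 Prop. 4.12 (i) with `Õ(L, h) = O(L, h)`: `Õ(h^⊥) = O(L, h)|_{h^⊥}` when `|D(L)| ≤ 2` -/

/-- **`Õ(h^⊥) = {G|_{h^⊥} | G ∈ O(L), G h = h}` when `|D(L)| ≤ 2`** (`B` nondegenerate symmetric on a finitely generated
free `ℤ`-module, `(h, h) ≠ 0`): Prop. 4.12 (i) `Õ(h^⊥) = Õ(L, h)|_{h^⊥}` together with `Õ(L) = O(L)`. For `L` unimodular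
(`|D(L)| = 1`) this is Huybrechts' Cor. 14.2.7; for `L = L_2` (`|D(L_2)| = 2`) it is "`Õ(L_{2,2d}) = O(L_2, h_d)`".
[cite: GritsenkoHulekSankaran2010Symplectic, §5 (display after "where `t = 1`") and §4 Prop. 4.12 (i)] [cite: Huybrechts2016K3, Ch. 14 Cor. 2.7] -/
theorem setOf_discriminantGroupCongr_eq_id_eq_setOf_exists_apply_eq_of_natCard_le_two (hBn : B.Nondegenerate)
    (hB : B.IsSymm) (h2 : Nat.card B.discriminantGroup ≤ 2) {h : M} (hh : B h h ≠ 0) :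
    {g : (B.restrict (B.orthogonal (ℤ ∙ h))).IsometryEquiv (B.restrict (B.orthogonal (ℤ ∙ h))) |
        ∀ a, g.discriminantGroupCongr a = a} =
      {g | ∃ G : B.IsometryEquiv B, G h = h ∧ ∀ n : B.orthogonal (ℤ ∙ h), G n = g n} := by
  rw [B.setOf_discriminantGroupCongr_eq_id_eq_setOf_exists_stable_apply_eq hBn hB hh]
  ext g
  simp only [Set.mem_setOf_eq]
  exact ⟨fun ⟨G, _, hGh, hGn⟩ ↦ ⟨G, hGh, hGn⟩,
    fun ⟨G, hGh, hGn⟩ ↦ ⟨G, B.discriminantGroupCongr_eq_self_of_natCard_le_two hBn h2 G, hGh, hGn⟩⟩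

/-- **`Õ(S^⊥) = {G|_{S^⊥} | G ∈ O(L), G|_S = id}` when `|D(L)| ≤ 2`**, for any submodule `S` with `B|_{S^⊥}` nondegenerate
(`B` nondegenerate symmetric). [cite: GritsenkoHulekSankaran2010Symplectic, §4 Prop. 4.12 (i) and Cor. 4.13] [cite: Huybrechts2016K3, Ch. 14 Cor. 2.7] -/
theorem setOf_discriminantGroupCongr_eq_id_eq_setOf_exists_forall_apply_eq_of_natCard_le_two (hBn : B.Nondegenerate)
    (hB : B.IsSymm) (h2 : Nat.card B.discriminantGroup ≤ 2) (S : Submodule ℤ M)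
    (hT : (B.restrict (B.orthogonal S)).Nondegenerate) :
    {g : (B.restrict (B.orthogonal S)).IsometryEquiv (B.restrict (B.orthogonal S)) |
        ∀ a, g.discriminantGroupCongr a = a} =
      {g | ∃ G : B.IsometryEquiv B, (∀ s ∈ S, G s = s) ∧ ∀ n : B.orthogonal S, G n = g n} := by
  rw [B.setOf_discriminantGroupCongr_eq_id_eq_setOf_exists_stable hB S hT]
  ext g
  simp only [Set.mem_setOf_eq]
  exact ⟨fun ⟨G, _, hGS, hGn⟩ ↦ ⟨G, hGS, hGn⟩,
    fun ⟨G, hGS, hGn⟩ ↦ ⟨G, B.discriminantGroupCongr_eq_self_of_natCard_le_two hBn h2 G, hGS, hGn⟩⟩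

/-- **`O(L, h) → Õ(h^⊥)` when `|D(L)| ≤ 2`**: every isometry fixing `h` restricts to `h^⊥` and the restriction acts
trivially on `D(h^⊥)` ("`Õ(L_{2,2d}) = … = O(L_2, h_d)`", the map). [cite: GritsenkoHulekSankaran2010Symplectic, §5 and §4 Prop. 4.12 (i)] -/
theorem exists_restrict_discriminantGroupCongr_eq_id_of_apply_eq_of_natCard_le_two (hBn : B.Nondegenerate) (hB : B.IsSymm) (h2 : Nat.card B.discriminantGroup ≤ 2) {h : M} (G : B.IsometryEquiv B)
    (hGh : G h = h) :
    ∃ g : (B.restrict (B.orthogonal (ℤ ∙ h))).IsometryEquiv (B.restrict (B.orthogonal (ℤ ∙ h))),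
      (∀ n : B.orthogonal (ℤ ∙ h), (g n : M) = G n) ∧ ∀ a, g.discriminantGroupCongr a = a :=
  B.exists_restrict_discriminantGroupCongr_eq_id_of_apply_eq_of_discriminantGroupCongr_eq_id hB G hGh
    (B.discriminantGroupCongr_eq_self_of_natCard_le_two hBn h2 G)

end Small

end LinearMap.BilinForm

namespace Literature.Topology.FourManifolds

open LinearMap.BilinForm

/-! ### §3 `L_2 = B₀ ⊕ ⟨−2⟩`: `|D| = 2`, `Õ(L_2) = O(L_2)`, `Õ(L_{2,2d}) = Õ(L_2, h_d) = O(L_2, h_d)` -/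

section Model

variable {M : Type*} [AddCommGroup M] [Module.Finite ℤ M] [Module.Free ℤ M] (B₀ : BilinForm ℤ M) (t : ℕ)

/-- **`|D(B₀ ⊕ ⟨−2t⟩)| = 2t`** for `B₀` symmetric unimodular (`D(L_{2t}) ≅ ℤ/2t`: "`2t = −det(L_{2t})`").
[cite: GritsenkoHulekSankaran2010Symplectic, §4 ("`div(h_d)` is a common divisor of `2d` and `2t = −det(L_{2t})`"; "the discriminant group of `L_{2t}` is cyclic")] -/
theorem natCard_discriminantGroup_prod_neg_twoMul_smul_mul (hu : B₀.IsUnimodular) :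
    Nat.card (B₀.prod ((-(2 * t : ℤ)) • LinearMap.mul ℤ ℤ)).discriminantGroup = 2 * t := by
  have hneg : ((-(2 * t : ℤ)) • LinearMap.mul ℤ ℤ) = -((2 * t : ℤ) • LinearMap.mul ℤ ℤ) := neg_smul _ _
  rw [natCard_discriminantGroup_prod, hneg, natCard_discriminantGroup_neg, natCard_discriminantGroup_twoMul_smul_mul,
    (isUnimodular_iff_natCard_discriminantGroup_eq_one B₀ hu.nondegenerate).1 hu, one_mul]

omit [Module.Finite ℤ M] [Module.Free ℤ M] in
/-- `B₀ ⊕ ⟨−2⟩` is nondegenerate (`B₀` unimodular). [cite: GritsenkoHulekSankaran2010Symplectic, §4 ("By lattice … we always mean a non-degenerate lattice")] -/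
theorem nondegenerate_prod_neg_two_smul_mul (hu : B₀.IsUnimodular) :
    (B₀.prod ((-2 : ℤ) • LinearMap.mul ℤ ℤ)).Nondegenerate := by
  have h := nondegenerate_prod_neg_twoMul_smul_mul B₀ 1 hu one_pos
  simp only [Nat.cast_one, mul_one] at h
  exact h

/-- `|D(B₀ ⊕ ⟨−2⟩)| = 2` (`D(L_2) ≅ ℤ/2`). [cite: GritsenkoHulekSankaran2010Symplectic, §4 ("`2t = −det(L_{2t})`") and §5 ("where `t = 1`")] -/
theorem natCard_discriminantGroup_prod_neg_two_smul_mul (hu : B₀.IsUnimodular) :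
    Nat.card (B₀.prod ((-2 : ℤ) • LinearMap.mul ℤ ℤ)).discriminantGroup = 2 := by
  have h := natCard_discriminantGroup_prod_neg_twoMul_smul_mul B₀ 1 hu
  simp only [Nat.cast_one, mul_one] at h
  exact h

/-- **`Õ(L_2) = O(L_2)`**: every isometry of `B₀ ⊕ ⟨−2⟩` (`B₀` symmetric unimodular; `D ≅ ℤ/2`) acts trivially on the
discriminant group. [cite: GritsenkoHulekSankaran2010Symplectic, §5 ("where `t = 1`, we have `Õ(L_{2,2d}) = Õ(L_2,h_d) = O(L_2,h_d)`")] -/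
theorem discriminantGroupCongr_eq_self_of_prod_neg_two (hu : B₀.IsUnimodular)
    (g : (B₀.prod ((-2 : ℤ) • LinearMap.mul ℤ ℤ)).IsometryEquiv (B₀.prod ((-2 : ℤ) • LinearMap.mul ℤ ℤ)))
    (a : (B₀.prod ((-2 : ℤ) • LinearMap.mul ℤ ℤ)).discriminantGroup) : g.discriminantGroupCongr a = a :=
  discriminantGroupCongr_eq_self_of_natCard_le_two _ (nondegenerate_prod_neg_two_smul_mul B₀ hu)
    (by rw [natCard_discriminantGroup_prod_neg_two_smul_mul B₀ hu]) g a

/-- **`Õ(L_{2,2d}) = Õ(L_2, h_d) = O(L_2, h_d)`** for `L_2`-type lattices `B₀ ⊕ ⟨−2⟩` (`B₀` symmetric unimodular; for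
`B₀ = 3U ⊕ 2E₈(−1)` this is the Beauville lattice of `K3^{[2]}`) and every `h` with `h² = 2d ≠ 0`: the isometries of
`h^⊥` trivial on `D(h^⊥)` are exactly the restrictions of the isometries of `L_2` fixing `h` (all of which lie in
`Õ(L_2)`; restriction is injective by `isometryEquiv_apply_eq_of_apply_eq_of_forall_coe_apply_eq`). For split `h_d`,
`h_d^⊥ ≅ L_{2,2d}` (`LatticeFormsPolarisationTypesSplitNonsplit.lean`). [cite: GritsenkoHulekSankaran2010Symplectic, §5 (display after "where `t = 1`"), §4 Prop. 4.12 (i), Cor. 4.13] -/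
theorem setOf_discriminantGroupCongr_eq_id_eq_of_prod_neg_two (hs : B₀.IsSymm) (hu : B₀.IsUnimodular)
    {h : M × ℤ} {d : ℤ} (hd : d ≠ 0) (hh : B₀.prod ((-2 : ℤ) • LinearMap.mul ℤ ℤ) h h = 2 * d) :
    {g : ((B₀.prod ((-2 : ℤ) • LinearMap.mul ℤ ℤ)).restrict
          ((B₀.prod ((-2 : ℤ) • LinearMap.mul ℤ ℤ)).orthogonal (ℤ ∙ h))).IsometryEquiv
        ((B₀.prod ((-2 : ℤ) • LinearMap.mul ℤ ℤ)).restrict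
          ((B₀.prod ((-2 : ℤ) • LinearMap.mul ℤ ℤ)).orthogonal (ℤ ∙ h))) |
        ∀ a, g.discriminantGroupCongr a = a} =
      {g | ∃ G : (B₀.prod ((-2 : ℤ) • LinearMap.mul ℤ ℤ)).IsometryEquiv
          (B₀.prod ((-2 : ℤ) • LinearMap.mul ℤ ℤ)),
        G h = h ∧ ∀ n : (B₀.prod ((-2 : ℤ) • LinearMap.mul ℤ ℤ)).orthogonal (ℤ ∙ h), G n = g n} :=
  setOf_discriminantGroupCongr_eq_id_eq_setOf_exists_apply_eq_of_natCard_le_two _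
    (nondegenerate_prod_neg_two_smul_mul B₀ hu) (hs.prod (isSymm_smul_mul _))
    (by rw [natCard_discriminantGroup_prod_neg_two_smul_mul B₀ hu]) (by rw [hh]; omega)

variable (m k : ℕ)

/-- `|D((E₈(−1)^{⊕m} ⊕ U^{⊕k}) ⊕ ℤ(−2t))| = 2t` (`L_{2t}`: `m = 2`, `k = 3`).
[cite: GritsenkoHulekSankaran2010Symplectic, §4 ("`2t = −det(L_{2t})`")] -/
theorem natCard_discriminantGroup_model :
    Nat.card (((LinearMap.BilinForm.pi fun _ : Fin m ↦ -e8Form).prod (hyperbolicSum k)).prod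
      ((-(2 * t : ℤ)) • LinearMap.mul ℤ ℤ)).discriminantGroup = 2 * t := by
  obtain ⟨-, -, huB⟩ := isSymm_isEven_isUnimodular_pi_neg_e8Form_prod_hyperbolicSum' m k
  exact natCard_discriminantGroup_prod_neg_twoMul_smul_mul _ t huB

/-- **`Õ(L_{2,2d}) = Õ(L_2, h_d) = O(L_2, h_d)` for the model `L_2 = (E₈(−1)^{⊕m} ⊕ U^{⊕k}) ⊕ ℤ(−2)`** (`K3^{[2]}`:
`m = 2`, `k = 3`) and every `h` with `h² = 2d ≠ 0`. [cite: GritsenkoHulekSankaran2010Symplectic, §5 (display after "where `t = 1`"), §4 Prop. 4.12 (i), Cor. 4.13] -/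
theorem setOf_discriminantGroupCongr_eq_id_eq_of_model_one
    {h : ((Fin m → Fin 8 → ℤ) × ((Fin k → ℤ) × (Fin k → ℤ))) × ℤ} {d : ℤ} (hd : d ≠ 0)
    (hh : (((LinearMap.BilinForm.pi fun _ : Fin m ↦ -e8Form).prod (hyperbolicSum k)).prod
      ((-2 : ℤ) • LinearMap.mul ℤ ℤ)) h h = 2 * d) :
    {g : ((((LinearMap.BilinForm.pi fun _ : Fin m ↦ -e8Form).prod (hyperbolicSum k)).prod
            ((-2 : ℤ) • LinearMap.mul ℤ ℤ)).restrict
          ((((LinearMap.BilinForm.pi fun _ : Fin m ↦ -e8Form).prod (hyperbolicSum k)).prod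
            ((-2 : ℤ) • LinearMap.mul ℤ ℤ)).orthogonal (ℤ ∙ h))).IsometryEquiv
        ((((LinearMap.BilinForm.pi fun _ : Fin m ↦ -e8Form).prod (hyperbolicSum k)).prod
            ((-2 : ℤ) • LinearMap.mul ℤ ℤ)).restrict
          ((((LinearMap.BilinForm.pi fun _ : Fin m ↦ -e8Form).prod (hyperbolicSum k)).prod
            ((-2 : ℤ) • LinearMap.mul ℤ ℤ)).orthogonal (ℤ ∙ h))) |
        ∀ a, g.discriminantGroupCongr a = a} =
      {g | ∃ G : (((LinearMap.BilinForm.pi fun _ : Fin m ↦ -e8Form).prod (hyperbolicSum k)).prod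
            ((-2 : ℤ) • LinearMap.mul ℤ ℤ)).IsometryEquiv
          (((LinearMap.BilinForm.pi fun _ : Fin m ↦ -e8Form).prod (hyperbolicSum k)).prod
            ((-2 : ℤ) • LinearMap.mul ℤ ℤ)),
        G h = h ∧ ∀ n : (((LinearMap.BilinForm.pi fun _ : Fin m ↦ -e8Form).prod (hyperbolicSum k)).prod
            ((-2 : ℤ) • LinearMap.mul ℤ ℤ)).orthogonal (ℤ ∙ h), G n = g n} := by
  obtain ⟨hsB, -, huB⟩ := isSymm_isEven_isUnimodular_pi_neg_e8Form_prod_hyperbolicSum' m k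
  exact setOf_discriminantGroupCongr_eq_id_eq_of_prod_neg_two _ hsB huB hd hh

end Model

end Literature.Topology.FourManifolds
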